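import Summits.HodgeConjecture.HodgeConjecture.Theorems.VHCAbelianSchemesRoadTwistedDoorIsoSigma
import Summits.Ventures.HSemireg.HomComplexSigmaOfSchemeIso
import Summits.Ventures.HSemireg.SigmaAdmissibleOfSchemeIso
import HarnessLib

/-!
# Road b02 (`VHCAbelianSchemesRoad`, D-0059) — the crux's TWISTED DOOR `AdmTw` RESPECTS ISOMORPHISMS of `ℂ`-schemes, UNCONDITIONALLY
# (`hσC` of `VHCAbelianSchemesRoadTwistedDoorIsoSigma` DISCHARGED by `HomComplex.IsISemiregularC.of_schemeIso`)

research route conditional on HC_CM; not a corollary; Q11.4-sentence-2 already refuted in dim ≥ 3.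

FACT-FREE bookkeeping (seat ring2-b06 gen 119; helper `--supports stmt-HodgeConjecture-19787`; the crux skeleton of record (v3.1) is
untouched). The chain of reductions of the crux door's iso-respect obligation — ring2-b02 gen 87 D1/D2 (`h𝒪`/`hresp`/`htr` ⟶ `hσ`, pull-back
invariance of the venture's gluable σ-notion), ring2-b06 gen 118 (`hσ` ⟶ `hσC`, Buchweitz–Flenner joint injectivity `IsISemiregularC` along `e^*`,
`AmplificationChainSigmaGluableOfSchemeIso` / `VHCAbelianSchemesRoadTwistedDoorIsoSigma`) — is CLOSED by the venture file
`HomComplexSigmaOfSchemeIso.lean` (this seat, gen 119), which proves `hσC` (`HomComplex.IsISemiregularC.of_schemeIso`: σ_q of a strictly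
perfect complex along an isomorphism of the base scheme — unit, descended `𝓗om•`, complex Atiyah powers and supertrace along `e_*`, with
`D(e_*)` bijective on shifted Homs). THIS FILE records the unconditional statements: `isISemiregularC_of_schemeIso` (the `hσC` hypothesis,
verbatim, as a theorem), **`twistedDoor_respectsIso`**, `secantAnchor_transport_twistedDoor`, `design_on_self_of_designModLefschetzAt_twistedDoor` —
D2's three displayed-hypothesis theorems with NO hypothesis left — and `sigmaAdmissible_pullback_of_schemeIso` (target seat 7's σ-admissibility
transports along `e^*`; gen 118's `sigmaAdmissible_pullback_of_schemeIso_of_isISemiregularC` discharged). One-liners over the files composed; no new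
mathematics here.

Nothing here says any cell, carrier statement, residual, K-SR♭∃, VHC, `HC_AV` or HC holds; `HC_CM` occurs nowhere; no statement of any
item is touched. References: [cite: BuchweitzFlenner2003, Def. 4.1 and §5 (I-semiregular)] [cite: Lieblich2006, Prop. 2.1.9]
[cite: Perry2026Semiregularity, Thm. 1.1 (hypotheses)] [cite: Bloch1972Semiregularity, Remark (7.5)].
-/

noncomputable section

open CategoryTheory CategoryTheory.Limits AlgebraicGeometry Topology
open AlgebraicGeometry.Scheme.Modules

namespace Summit.HodgeConjecture.HodgeConjecture.Ring2.SemiregularRepresentatives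

-- the cell's namespace repeats the summit name (`Summit.HodgeConjecture.HodgeConjecture…`), as in every `Ring2*` file
set_option linter.dupNamespace false

open Literature.AlgebraicGeometry Literature.AlgebraicGeometry.Motives Literature.AlgebraicGeometry.Modules
open Literature.AlgebraicGeometry.HodgeTheory
open Literature.AlgebraicGeometry.KTheory
open Literature.AlgebraicTopology.SingularHomology
open Literature.Barriers.HodgeConjecture (divisorClassesSpan)

/-- **The σ_q-level statement `hσC`, PROVED**: Buchweitz–Flenner joint injectivity `(σ_q)_{q ∈ J}` of a strictly perfect complex transports
along pull-back by every isomorphism of `ℂ`-schemes (the venture's `HomComplex.IsISemiregularC.of_schemeIso`, instantiated at the standard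
derived categories — VERBATIM the hypothesis of `twistedDoor_respectsIso_of_isISemiregularC`).
[cite: BuchweitzFlenner2003, Def. 4.1 and §5 (I-semiregular)] -/
theorem isISemiregularC_of_schemeIso :
    ∀ ⦃Y Y' : SchemeOver ℂ⦄ (e : Y' ≅ Y) (E : CochainComplex Y.left.Modules ℤ) (a b : ℤ)
      [E.IsStrictlyGE a] [E.IsStrictlyLE b] (hE : ∀ i, IsFiniteLocallyFree (E.X i)) (J : Set ℕ),
      letI := HasDerivedCategory.standard Y.left.Modules
      letI := HasDerivedCategory.standard Y'.left.Modules
      Summit.Ventures.HSemireg.HomComplex.IsISemiregularC Y E a b hE J →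
        Summit.Ventures.HSemireg.HomComplex.IsISemiregularC Y' (((Scheme.Modules.pullback e.hom.left).mapHomologicalComplex _).obj E) a b
          (fun i => (hE i).pullback e.hom.left) J := fun Y Y' e E a b _ _ hE J => by
  letI := HasDerivedCategory.standard Y.left.Modules
  letI := HasDerivedCategory.standard Y'.left.Modules
  exact fun h => Summit.Ventures.HSemireg.HomComplex.IsISemiregularC.of_schemeIso e E a b hE J h

variable (C : ChernCharacterBetti)

/-- **The crux's twisted door `twistedReflexiveClass C AdmTw`, `AdmTw := gluableSigmaAdmissible ∨ bfSingleAdmissible`, RESPECTS ISOMORPHISMS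
of `ℂ`-schemes** — unconditionally (D2's `twistedDoor_respectsIso_of_sigmaPullback` / gen 118's `…_of_isISemiregularC` with the σ_q-level
hypothesis discharged by `isISemiregularC_of_schemeIso`). [cite: BuchweitzFlenner2003, Def. 4.1 and §5 (I-semiregular)]
[cite: Perry2026Semiregularity, Thm. 1.1 (hypotheses)] -/
theorem twistedDoor_respectsIso :
    ∀ (n : ℕ) ⦃Y Y' : SchemeOver ℂ⦄ (e : Y' ≅ Y) (I : Finset ℕ) (κ : (q : ℕ) → complexBetti Y (2 * q)),
      Literature.AlgebraicGeometry.HodgeTheory.twistedReflexiveClass C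
          (fun n X₀ I E => Summit.Ventures.HSemireg.gluableSigmaAdmissible n X₀ I E ∨
            Literature.AlgebraicGeometry.HodgeTheory.bfSingleAdmissible n X₀ I E) n Y I κ →
        Literature.AlgebraicGeometry.HodgeTheory.twistedReflexiveClass C
          (fun n X₀ I E => Summit.Ventures.HSemireg.gluableSigmaAdmissible n X₀ I E ∨
            Literature.AlgebraicGeometry.HodgeTheory.bfSingleAdmissible n X₀ I E) n Y' I
          (fun q ↦ complexBetti.map e.hom (2 * q) (κ q)) :=
  twistedDoor_respectsIso_of_isISemiregularC C isISemiregularC_of_schemeIso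

/-- **L3's transport of the secant-anchor data, unconditionally**: `θ ∈` secant anchors of `X` and `w` served there give `e.inv^*θ ∈` secant
anchors of `X'` and `e.inv^*w` served there, for `e : X ≅ X'`. [folklore] [cite: HatcherAT2002, Prop. 3.10] -/
theorem secantAnchor_transport_twistedDoor :
    ∀ ⦃X X' : SchemeOver ℂ⦄ (e : X ≅ X') (θ : complexBetti X 2) (w : complexBetti X (2 * 3)),
      θ ∈ secantAnchorSixfold C X → w ∈ secantServedClasses C X θ →
        complexBetti.map e.inv 2 θ ∈ secantAnchorSixfold C X' ∧
          complexBetti.map e.inv (2 * 3) w ∈ secantServedClasses C X' (complexBetti.map e.inv 2 θ) :=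
  secantAnchor_transport_of_isISemiregularC C isISemiregularC_of_schemeIso

/-- **PART Z-c's design-on-self for the TWISTED door, unconditionally in the door's iso-respect**: the per-variety lower bound
`DesignModLefschetzAt (tw C AdmTw) n p` yields its twisted datum ON `X` itself. [cite: Bloch1972Semiregularity, Remark (7.5)]
[cite: Perry2026Semiregularity, Thm. 1.1 (hypotheses)] -/
theorem design_on_self_of_designModLefschetzAt_twistedDoor {n p : ℕ}
    (h : DesignModLefschetzAt (Literature.AlgebraicGeometry.HodgeTheory.twistedReflexiveClass C
      (fun n X₀ I E => Summit.Ventures.HSemireg.gluableSigmaAdmissible n X₀ I E ∨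
        Literature.AlgebraicGeometry.HodgeTheory.bfSingleAdmissible n X₀ I E)) n p)
    (X : SchemeOver ℂ) (hX : ∃ A : AbelianVariety ℂ, A.dim = n ∧ Nonempty (A.X ≅ X))
    (w : complexBetti X (2 * p)) (hwQ : IsRationalClass w) (hwalg : w ∈ algebraicClasses X p) (hwD : w ∉ divisorClassesSpan X n p) :
    ∃ (I : Finset ℕ) (κ : (q : ℕ) → complexBetti X (2 * q)) (a : ℂ) (z : complexBetti X (2 * p)),
      p ∈ I ∧ Literature.AlgebraicGeometry.HodgeTheory.twistedReflexiveClass C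
        (fun n X₀ I E => Summit.Ventures.HSemireg.gluableSigmaAdmissible n X₀ I E ∨
          Literature.AlgebraicGeometry.HodgeTheory.bfSingleAdmissible n X₀ I E) n X I κ ∧
      a ≠ 0 ∧ z ∈ algebraicClasses X p ∧ z ∈ divisorClassesSpan X n p ∧ κ p = a • w + z ∧
      ∀ q ∈ I, IsOfHodgeType n X (2 * q) q q (κ q) :=
  design_on_self_of_designModLefschetzAt_tw_of_isISemiregularC C isISemiregularC_of_schemeIso h X hX w hwQ hwalg hwD

/-- **Target seat 7's σ-admissibility notion `sigmaAdmissible` (gluable ∧ `Hom = ℂ`) transports along pull-back by isomorphisms of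
`ℂ`-schemes**, unconditionally (gen 118's `sigmaAdmissible_pullback_of_schemeIso_of_isISemiregularC` with `hσC` discharged).
[cite: BuchweitzFlenner2003, Def. 4.1 and §5 (I-semiregular)] [cite: Lieblich2006, Prop. 2.1.9] -/
theorem sigmaAdmissible_pullback_of_schemeIso :
    ∀ (n : ℕ) ⦃Y Y' : SchemeOver ℂ⦄ (e : Y' ≅ Y) (I : Finset ℕ) (E : CochainComplex Y.left.Modules ℤ),
      IsBoundedVBComplex E → Summit.Ventures.HSemireg.sigmaAdmissible n Y I E →
        Summit.Ventures.HSemireg.sigmaAdmissible n Y' I (((Scheme.Modules.pullback e.hom.left).mapHomologicalComplex _).obj E) :=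
  Summit.Ventures.HSemireg.sigmaAdmissible_pullback_of_schemeIso_of_isISemiregularC isISemiregularC_of_schemeIso

end Summit.HodgeConjecture.HodgeConjecture.Ring2.SemiregularRepresentatives

end
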